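import Summits.ValiantsHypothesis.ValiantsHypothesis.Theorems.LacunarySymmetroidMatrixDescartesFiniteSectorRealisable

/-!
# `MatrixDescartes` — line «stamp»: `FullyRealisable 2 ![0, 1, 3] 4` — the K = 3 stamp record
# `ν(2,3) = 4 = n(2,2)` on `(0,1,3)` as a kernel certificate (degree drops to the postage-stamp number)

HONEST FRAMING.  Object-search cell `pub-symmetroid`, seat val-sym-door-p5 g7 (STAMP-G6 fallback runner tonight, desk R2441 (A) /
R2457 (A); the G6 job itself is val-sym-engine-7's).  HELPER of the crux item `stmt-ValiantsHypothesis-18050`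
(`Summit.ValiantsHypothesis.ValiantsHypothesis.Theses.LacunarySymmetroid.MatrixDescartes`, asymptotic in `K`) with NO closure claim.  The crux
workfile `Cruxes/MatrixDescartes/Lines/stamp.lean` (val-idea-6 g3; critic verdict #23 = PASS, instrument tier; definitions in `…FiniteSectorDefs`)
records as LOCATED that at `m = 2` the full realisations sit EXACTLY at the postage-stamp number `n(2,K−1)`: `(2,3)` 4 on `(0,1,3)`, `(2,4)` 8 on
`(0,1,3,4)`, `(2,5)` 12 on `(0,1,3,5,6)` (engine-5 wave W1).  `K = 5` is kernel (`fullyRealisable_two_01356_12`, …StampFull01356, val-sym-engine-7) and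
`K = 4` is kernel (`fullyRealisable_two_0134_8`, …StampFull0134); this file is the `K = 3` row.  On `(0,1,3)` the pair-sum set `{0,1,2,3,4,6}` misses
`5`, so a degree-6 determinant cannot be full (Descartes); fullness at the stamp number `n(2,2) = 4` needs the TOP letter to be rank one (`det S₂ = 0`,
so the `X⁶` coefficient vanishes) and four distinct positive zeros of the remaining quartic.  Witness (found by a 30 000-trial exact integer search,
val-sym-door-p5 g7, `work/full013/`): `S₀ = !![4, −7; −7, 12]`, `S₁ = !![−10, 11; 11, 6]`, `S₂ = !![9, 3; 3, 1]` (= `(3,1)(3,1)ᵀ`), determinant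
`−22 X⁴ + 154 X³ − 181 X² + 58 X − 1` with four positive zeros (≈ 0.019, 0.534, 0.828, 5.62).  Nothing here bears on the crux, on G6–G9, on the
doors, or on `VP ≠ VNP`.

Method (all exact, `norm_num`): closed form of `det (∑ l, t ^ d l • S l)` by `Matrix.det_fin_two` + `ring` (degree `≤ 4` by `compute_degree`);
`5` strictly increasing positive dyadic rationals `1/128 < 1/32 < 9/16 < 7/8 < 6` with alternating determinant signs (−+−+−) give `≥ 4` distinct
positive zeros and `fullyRealisable_of_certificate` (`…FiniteSectorRealisable`, val-sym-eng-3 g4, p605516) concludes.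
[folklore] Descartes / intermediate value theorem bookkeeping; no citation exists or is needed.
-/

-- `Summit.ValiantsHypothesis.ValiantsHypothesis.…` repeats a component by the D-0017 layout
-- (single-conjunct summit), which the `dupNamespace` linter flags; the name is mandated.
set_option linter.dupNamespace false

namespace Summit.ValiantsHypothesis.ValiantsHypothesis.Theorems.LacunarySymmetroidMatrixDescartes.FiniteSector

open scoped BigOperators Matrix
open Polynomial

/-- Closed form of the determinant of the witness half-pencil on `(0, 1, 3)` (the three symmetric integer matrices in this
statement ARE the witness; the top letter `!![9, 3; 3, 1]` is rank one, so the degree is `4`, not `6`). [folklore] -/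
theorem eval_det_G3 (t : ℝ) :
    (∑ l, t ^ (![0, 1, 3] : Fin 3 → ℕ) l •
      ((![!![4, -7; -7, 12],
       !![-10, 11; 11, 6],
       !![9, 3; 3, 1]] : Fin 3 → Matrix (Fin 2) (Fin 2) ℝ) l)).det =
      (C (-22) * X ^ 4 + C 154 * X ^ 3 + C (-181) * X ^ 2 + C 58 * X + C (-1) : ℝ[X]).eval t := by
  simp [Matrix.det_fin_two, Fin.sum_univ_succ]
  ring

/-- **`FullyRealisable 2 ![0, 1, 3] 4`** (`ν(2,3) = 4 = n(2,2)` realised): a real symmetric `2 × 2` half-pencil on `(0, 1, 3)` whose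
determinant has degree exactly `4` and `4` distinct positive zeros.  Certificate: the determinant alternates in sign at the `5` points
`1/128, 1/32, 9/16, 7/8, 6`. [folklore] -/
theorem fullyRealisable_two_013_4 : FullyRealisable 2 (![0, 1, 3] : Fin 3 → ℕ) 4 := by
  refine fullyRealisable_of_certificate (n := 4) ![0, 1, 3]
    (![!![4, -7; -7, 12],
       !![-10, 11; 11, 6],
       !![9, 3; 3, 1]] : Fin 3 → Matrix (Fin 2) (Fin 2) ℝ)
    (by intro l; fin_cases l <;> (unfold Matrix.IsSymm; ext i j; fin_cases i <;> fin_cases j <;> rfl))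
    _ eval_det_G3 (by compute_degree)
    (![1 / 128, 1 / 32, 9 / 16, 7 / 8, 6] : Fin 5 → ℝ) ?_ ?_ ?_
  · refine Fin.strictMono_iff_lt_succ.2 fun j => ?_
    fin_cases j <;> simp only [Fin.castSucc_mk, Fin.succ_mk] <;> norm_num
  · intro j; fin_cases j <;> norm_num
  · intro j
    fin_cases j <;> simp only [eval_det_G3, Fin.castSucc_mk, Fin.succ_mk, eval_add, eval_mul, eval_C, eval_X,
      eval_pow] <;> norm_num

end Summit.ValiantsHypothesis.ValiantsHypothesis.Theorems.LacunarySymmetroidMatrixDescartes.FiniteSector
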